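import Mathlib
import Summits.Ventures.PercRepro2.SwOutSevOrbit

/-!
# The coarse orbit of a core-free point of a several-arms block stays in the block, II (blind
cell PercRepro2, night-4 g22, 2026-08-27; proofs/NIGHT4-G22.md §4)

The toggled point of a slab point under an arm-closed set does not leak (`not_leak_toggleWR`:
with `u ∈ W` a T-slab point goes to a B-slab point and back — the attached arms toggle with `u`,
the dropped arms keep their pieces and outside edges; with `u ∉ W` only the pieces of the dropped
arms and the far arms toggle); a core-free non-leaking point is a slab point (`slab_of_coreFree`:
with a u-arm on each side `u` would be a core).  Hence **every point of the coarse orbit of a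
core-free point of the block is a point of the block** (`exists_mixedRealR_of_mem_orbit`).
-/

namespace Summit.Ventures.PercRepro2

namespace MixedArms

open Hull LocRows BigBlock

variable {V : Type*} {E : Type*} [Fintype E] [DecidableEq E]

open scoped Classical

variable {ι ρ ν κ : Type*} {ends : E → Sym2 V} {σ : Config E} {h u : V} {U : ι → Set V}
  {p : ρ → V} {Ah : ν → Set V} {arm : ν → ρ} {F : κ → Set V}

variable (hb : MixedBaseR ends σ h u U p Ah arm F)
include hb

section Leak

variable (hup : ∀ r, ∃ e, ends e = s(u, p r))
  (hdead : ∀ i, ∃ e y, ends e = s(p (arm i), y) ∧ y ∈ Ah i)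
  (hconnA : ∀ i, ∀ x ∈ Ah i, ∀ y ∈ Ah i, y ∈ cluster ends (fun e => decide (e ∈ within ends (Ah i))) x)
  {q : PtR ι ρ ν κ} (hqR : ¬ LeakRR arm q) (hqB : ¬ LeakBR arm q)
  {W : Set V} (hW : ArmClosed ends (mixedRealR ends u U p Ah F σ q) h W)
include hup hdead hconnA hqR hqB hW

omit [Fintype E] [DecidableEq E] in
/-- **The toggled point of a slab point does not leak.** -/
theorem MixedBaseR.not_leak_toggleWR [Nonempty ι] (hq : TSlab q arm ∨ BSlab q arm) :
    ¬ Leak (toggleWR u p Ah F q W) arm := by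
  have hpu := fun {r : ρ} (hp : p r ∈ W) => hb.u_mem_of_p_mem_R hup hqR hqB hW hp
  have hup' := fun (huW : u ∈ W) {r : ρ} hpH => hb.p_mem_of_u_mem_R hup hW huW (r := r) hpH
  have hAp := fun (i : ν) (hp : p (arm i) ∈ W) =>
    (hdead i).elim fun e he => he.elim fun y ⟨hey, hy⟩ =>
      hb.Ah_subset_of_p_mem_R hup hqR hqB hW i hey hy (hconnA i) hp
  have hpA := fun (i : ν) (hsub : Ah i ⊆ W) hpH =>
    (hdead i).elim fun e he => he.elim fun y ⟨hey, hy⟩ =>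
      hb.p_mem_of_Ah_subset_R hW i hey hy hsub hpH
  have hpH := fun r => (hb.p_mem_hull_iff_R hup hqR hqB r)
  rintro ⟨r, hr⟩
  simp only [LeakArm, toggleWR] at hr
  by_cases huW : u ∈ W
  · simp only [if_pos huW] at hr
    rcases hq with ⟨hs, hq⟩ | ⟨hs, hq⟩
    · -- T-slab, `u ∈ W`: the u-arms turn blue; a leak needs a dropped arm attached blue
      rcases hr with ⟨⟨j, hj⟩, -⟩ | ⟨-, huP, hr⟩
      · rw [hs] at hj; exact Bool.noConfusion hj
      · rw [Bool.not_eq_false'] at huP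
        rcases hq r with h' | ⟨ha, he⟩
        · rw [huP] at h'; exact Bool.noConfusion h'
        · have hpW : p r ∈ W := hup' huW ((hpH r).2 (Or.inl ⟨⟨Classical.arbitrary ι, by rw [hs]⟩, huP⟩))
          rcases hr with hr | ⟨i, hi, hr⟩
          · rw [if_pos hpW, he] at hr; exact Bool.noConfusion hr
          · have hsub : Ah i ⊆ W := hAp i (by rw [hi]; exact hpW)
            rw [if_pos hsub, ha i hi] at hr; exact Bool.noConfusion hr
    · -- B-slab, `u ∈ W`: the u-arms turn red; a leak needs an arm attached red with a blue piece
      rcases hr with ⟨-, huP, hr⟩ | ⟨⟨j, hj⟩, -⟩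
      · rw [Bool.not_eq_true'] at huP
        rcases hq r with h' | ⟨ha, he⟩
        · rw [huP] at h'; exact Bool.noConfusion h'
        · have hpW : p r ∈ W := hup' huW ((hpH r).2 (Or.inr ⟨⟨Classical.arbitrary ι, by rw [hs]⟩, huP⟩))
          rcases hr with hr | ⟨i, hi, hr⟩
          · rw [if_pos hpW, he] at hr; exact Bool.noConfusion hr
          · have hsub : Ah i ⊆ W := hAp i (by rw [hi]; exact hpW)
            rw [if_pos hsub, ha i hi] at hr; exact Bool.noConfusion hr
      · rw [hs] at hj; exact Bool.noConfusion hj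
  · simp only [if_neg huW] at hr
    have hpnot : ∀ r, p r ∉ W := fun r hp => huW (hpu hp)
    rcases hq with ⟨hs, hq⟩ | ⟨hs, hq⟩
    · -- T-slab, `u ∉ W`: only the pieces of the dropped arms and the far arms toggle
      rcases hr with ⟨-, huP, hr⟩ | ⟨⟨j, hj⟩, -⟩
      · rcases hq r with h' | ⟨ha, he⟩
        · rw [huP] at h'; exact Bool.noConfusion h'
        · have hpHr : p r ∈ hull ends (mixedRealR ends u U p Ah F σ q) h :=
            (hpH r).2 (Or.inl ⟨⟨Classical.arbitrary ι, by rw [hs]⟩, huP⟩)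
          rcases hr with hr | ⟨i, hi, hr⟩
          · rw [if_neg (hpnot r), he] at hr; exact Bool.noConfusion hr
          · have hnsub : ¬ Ah i ⊆ W := fun hsub => hpnot r (by rw [← hi]; exact hpA i hsub (by rw [hi]; exact hpHr))
            rw [if_neg hnsub, ha i hi] at hr; exact Bool.noConfusion hr
      · rw [hs] at hj; exact Bool.noConfusion hj
    · -- B-slab, `u ∉ W`
      rcases hr with ⟨⟨j, hj⟩, -⟩ | ⟨-, huP, hr⟩
      · rw [hs] at hj; exact Bool.noConfusion hj
      · rcases hq r with h' | ⟨ha, he⟩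
        · rw [huP] at h'; exact Bool.noConfusion h'
        · have hpHr : p r ∈ hull ends (mixedRealR ends u U p Ah F σ q) h :=
            (hpH r).2 (Or.inr ⟨⟨Classical.arbitrary ι, by rw [hs]⟩, huP⟩)
          rcases hr with hr | ⟨i, hi, hr⟩
          · rw [if_neg (hpnot r), he] at hr; exact Bool.noConfusion hr
          · have hnsub : ¬ Ah i ⊆ W := fun hsub => hpnot r (by rw [← hi]; exact hpA i hsub (by rw [hi]; exact hpHr))
            rw [if_neg hnsub, ha i hi] at hr; exact Bool.noConfusion hr

end Leak

section Slab

variable (hup : ∀ r, ∃ e, ends e = s(u, p r))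
include hup

omit [Fintype E] [DecidableEq E] in
/-- **A core-free non-leaking point is a slab point** (a u-arm on each side makes `u` a core). -/
theorem MixedBaseR.slab_of_coreFree [Nonempty ι] {q : PtR ι ρ ν κ} (hq : ¬ Leak q arm)
    (hc : CoreFree ends (mixedRealR ends u U p Ah F σ q) h) : TSlab q arm ∨ BSlab q arm := by
  obtain ⟨hqR, hqB⟩ := not_leak_iff_RB.1 hq
  -- the u-arms have one colour
  have hconst : (∀ j, q.1 j = true) ∨ ∀ j, q.1 j = false := by
    by_contra hcon
    have h1 : ∃ j, q.1 j = false := by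
      by_contra h'
      exact hcon (Or.inl fun j => by
        cases hj : q.1 j with
        | true => rfl
        | false => exact absurd ⟨j, hj⟩ h')
    have h2 : ∃ j, q.1 j = true := by
      by_contra h'
      exact hcon (Or.inr fun j => by
        cases hj : q.1 j with
        | true => exact absurd ⟨j, hj⟩ h'
        | false => rfl)
    obtain ⟨j₁, hj₁⟩ := h1
    obtain ⟨j₂, hj₂⟩ := h2
    have huR : u ∈ cluster ends (mixedRealR ends u U p Ah F σ q) h := by
      rw [hb.cluster_mixedRealR hup hqR, mem_redSetR_iff]
      exact Or.inr (Or.inr (Or.inl ⟨rfl, j₂, hj₂⟩))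
    have huB : u ∈ cluster ends (blue (mixedRealR ends u U p Ah F σ q)) h := by
      rw [hb.cluster_blue_mixedRealR hup hqB, mem_redSetR_iff]
      exact Or.inr (Or.inr (Or.inl ⟨rfl, j₁, by rw [flipPt_fst, hj₁]; rfl⟩))
    exact hb.hne_hu (hc u huR huB).symm
  rcases (not_leak_iff arm q).1 hq with hcore | hT | hB
  · rcases hconst with hs | hs
    · left
      refine ⟨funext hs, fun r => ?_⟩
      cases hr : q.2.2.1 r with
      | false => exact Or.inl rfl
      | true =>
        right
        exact ⟨fun i hi => by rw [hcore.1 i, hi, hr], by rw [← hcore.2 r, hr]⟩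
    · right
      refine ⟨funext hs, fun r => ?_⟩
      cases hr : q.2.2.1 r with
      | true => exact Or.inl rfl
      | false =>
        right
        exact ⟨fun i hi => by rw [hcore.1 i, hi, hr], by rw [← hcore.2 r, hr]⟩
  · exact Or.inl hT
  · exact Or.inr hB

end Slab

section Orbit

variable (hup : ∀ r, ∃ e, ends e = s(u, p r))
  (hdead : ∀ i, ∃ e y, ends e = s(p (arm i), y) ∧ y ∈ Ah i)
  (hconnU : ∀ j, ∀ x ∈ U j, ∀ y ∈ U j, y ∈ cluster ends (fun e => decide (e ∈ within ends (U j))) x)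
  (hconnA : ∀ i, ∀ x ∈ Ah i, ∀ y ∈ Ah i, y ∈ cluster ends (fun e => decide (e ∈ within ends (Ah i))) x)
  (hconnF : ∀ k, ∀ x ∈ F k, ∀ y ∈ F k, y ∈ cluster ends (fun e => decide (e ∈ within ends (F k))) x)
include hup hdead hconnU hconnA hconnF

/-- **Every point of the coarse orbit of a core-free point of the block is a point of the
block.** -/
theorem MixedBaseR.exists_mixedRealR_of_mem_orbit [Nonempty ι] {q : PtR ι ρ ν κ}
    (hq : ¬ Leak q arm) (hc : CoreFree ends (mixedRealR ends u U p Ah F σ q) h) {ζ'' : Config E}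
    (hζ'' : ζ'' ∈ orbit ends (allRed ends (mixedRealR ends u U p Ah F σ q) h) h) :
    ∃ q' : PtR ι ρ ν κ, ¬ Leak q' arm ∧ ζ'' = mixedRealR ends u U p Ah F σ q' := by
  obtain ⟨hqR, hqB⟩ := not_leak_iff_RB.1 hq
  obtain ⟨P, hP⟩ := exists_armsUnion_of_mem_orbit hc hζ''
  have hW := armClosed_armsUnion (ends := ends) (ζ := mixedRealR ends u U p Ah F σ q) (h := h) P
  refine ⟨toggleWR u p Ah F q (armsUnion (arms ends (mixedRealR ends u U p Ah F σ q) h) P),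
    hb.not_leak_toggleWR hup hdead hconnA hqR hqB hW (hb.slab_of_coreFree hup hq hc), ?_⟩
  rw [hP]
  exact hb.flip_armClosed_eq_mixedRealR hup hdead hconnU hconnA hconnF hqR hqB hW

end Orbit

end MixedArms

end Summit.Ventures.PercRepro2
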